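import Literature.Computability.Complexity.HashBricks
import Literature.Computability.Complexity.StockmeyerEstimator
import Literature.Computability.Complexity.PlumbingBricks
import Literature.Computability.Complexity.LengthCompare
import Literature.Computability.Complexity.TruthTableClosure
import Literature.Computability.Complexity.StringCopy
import Literature.Computability.Complexity.CountingProofs
import Literature.Computability.Complexity.CountingHierarchyPH
import Literature.Computability.Complexity.IsolationAdvice
import HarnessLib

/-!
# The `Mod_p` isolation relation of Bürgisser's Theorem 3.1 (machines)

Trunk T-CPLX-CORE. The polynomial-time relation behind Bürgisser, *Cook's versus Valiant's
hypothesis*, TCS 235 (2000), Thm. 3.1 (`NP/poly ⊆ Mod_pNP/poly`), proof pp. 78–79 with Lemma 3.2: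
given a relation `R ∈ P` (witnesses `y ∈ {0,1}^m` of `x`), a prime `p` and an advice string
`A = ⟨1^m, ⟨1^t, ⟨u₀, ⟨u₁, …⟩⟩⟩⟩` of `t` coin strings (affine hash seeds in the layout of
`StockmeyerEstimator.lean`), a relation `R'' ∈ P` on `⟨⟨x, A⟩, W⟩` whose number of witnesses `W` of
any length `≥ M` is `1 + ∏_{i < t·Lv} (p − 1 + Y_{i / Lv, i % Lv}(x))`, where
`Y_{j,k}(x) = #{y ∈ {0,1}^m | ⟨x, y⟩ ∈ R ∧ y hashes to 0 at level k under uⱼ}` (`levelCount`) and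
`Lv = 2⌊(m+3)/2⌋ + 1` (an odd number of levels `> m + 2`) — the cnf `φ` of Lemma 3.2(4) applied to
the Valiant–Vazirani restrictions `ψ_{j,k}` of the verifier, written directly as a witness format:
a flag bit (the extra `1`), then `t·Lv` blocks `y e` (`|y| = m`, `|e| = p − 1`: either `e = 0^{p−1}`
and `y` an isolated witness, or `e` of weight one and `y = 0^m` — the `p − 1` dummies), then
all-ones padding. Everything is assembled from the tree's `FP` bricks (`HashBricks`,
`PlumbingBricks`, `BrickAlgebra`) and closure properties of `P` (`StringCopy`, `StringEquality`,
`TruthTableClosure.ballLang`); no machine and no definition is introduced — each language is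
provided by an existence statement together with its semantics:

* `exists_hashZeroLang` — `⟨⟨u, 1^m⟩, ⟨1^k, y⟩⟩ ↦ [y hashes to 0 at level k under u]`
  (`Stockmeyer.HashesToZero`: a bounded quantifier over the rows, each an `𝔽₂` inner product
  `andParityFn` compared with the offset bit; cf. `StockmeyerMachines.hzLang`);
* `exists_blockLang` — the block test `⟨⟨x, ⟨u, 1^m⟩⟩, ⟨1^k, b⟩⟩ ↦ BlockOK`;
* `exists_isolationRel` — **the relation `R''` and its witness count** (`cnt_flag`, `cnt_blocks`,
  `cnt_block` of `IsolationAdvice.lean`).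

## References

* P. Bürgisser, *Cook's versus Valiant's hypothesis*, Theoret. Comput. Sci. 235 (2000) 71–88,
  Thm. 3.1, Lemma 3.2, pp. 77–79.
* L. G. Valiant, V. V. Vazirani, *NP is as easy as detecting unique solutions*, TCS 47 (1986).
* S. Arora, B. Barak, *Computational Complexity: A Modern Approach*, CUP 2009, §1.3, §17.4.1.
-/

namespace Literature.Computability.Complexity

open _root_.Computability Polynomial Brick Plumb OracleCompose HashBricks Stockmeyer

/-! ### The hash test -/

/-- **The hash-zero test is in `P`**: there is `HZ ∈ P` with
`⟨⟨u, 1^m⟩, ⟨1^k, y⟩⟩ ∈ HZ ↔ HashesToZero u m k y` (all rows `j' < k` of the level-`k` coin hash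
send `y` to `0`: row `j'` is the parity of `u[j'(m+1) …] ∧ y` xored with the offset bit
`u[j'(m+1) + m]`; a bounded quantifier `ballLang` over the rows, each row an `andParityFn` and a
`headBitFn` on shifted coins, as in `StockmeyerMachines.hzLang`). [folklore] -/
theorem exists_hashZeroLang : ∃ HZ : Language Bool, HZ ∈ Classes.P ∧
    ∀ (u : List Bool) (m k : ℕ) (y : List Bool),
      boolPair (boolPair u (ones m)) (boolPair (ones k) y) ∈ HZ ↔ HashesToZero u m k y := by
  -- parsers on `r = ⟨a, 1^{j'}⟩`, `a = ⟨⟨u, 1^m⟩, ⟨1^k, y⟩⟩`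
  have huR : (fstF ∘ fstF ∘ fstF) ∈ FP := comp_mem_FP fstF_mem_FP (comp_mem_FP fstF_mem_FP fstF_mem_FP)
  have hmR : (sndF ∘ fstF ∘ fstF) ∈ FP := comp_mem_FP sndF_mem_FP (comp_mem_FP fstF_mem_FP fstF_mem_FP)
  have hkR : (fstF ∘ sndF ∘ fstF) ∈ FP := comp_mem_FP fstF_mem_FP (comp_mem_FP sndF_mem_FP fstF_mem_FP)
  have hyR : (sndF ∘ sndF ∘ fstF) ∈ FP := comp_mem_FP sndF_mem_FP (comp_mem_FP sndF_mem_FP fstF_mem_FP)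
  -- `1^{j'(m+1)}`
  have hsR : (umulFn ∘ fanoutFn sndF (List.cons true ∘ (sndF ∘ fstF ∘ fstF))) ∈ FP :=
    comp_mem_FP umulFn_mem_FP (fanoutFn_mem_FP sndF_mem_FP (comp_mem_FP (cons_mem_FP true) hmR))
  have hdot : (andParityFn ∘ fanoutFn (dropFn ∘ fanoutFn
      (umulFn ∘ fanoutFn sndF (List.cons true ∘ (sndF ∘ fstF ∘ fstF))) (fstF ∘ fstF ∘ fstF))
      (sndF ∘ sndF ∘ fstF)) ∈ FP :=
    comp_mem_FP andParityFn_mem_FP (fanoutFn_mem_FP (comp_mem_FP dropFn_mem_FP (fanoutFn_mem_FP hsR huR)) hyR)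
  have hoff : (headBitFn ∘ dropFn ∘ fanoutFn (concatFn ∘ fanoutFn
      (umulFn ∘ fanoutFn sndF (List.cons true ∘ (sndF ∘ fstF ∘ fstF))) (sndF ∘ fstF ∘ fstF))
      (fstF ∘ fstF ∘ fstF)) ∈ FP :=
    comp_mem_FP headBitFn_mem_FP (comp_mem_FP dropFn_mem_FP (fanoutFn_mem_FP
      (comp_mem_FP concatFn_mem_FP (fanoutFn_mem_FP hsR hmR)) huR))
  refine ⟨ballLang X ((fanoutFn sndF (fstF ∘ sndF ∘ fstF) ⁻¹' LenLe X) ⊔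
      {r | (andParityFn ∘ fanoutFn (dropFn ∘ fanoutFn
          (umulFn ∘ fanoutFn sndF (List.cons true ∘ (sndF ∘ fstF ∘ fstF))) (fstF ∘ fstF ∘ fstF))
          (sndF ∘ sndF ∘ fstF)) r =
        (headBitFn ∘ dropFn ∘ fanoutFn (concatFn ∘ fanoutFn
          (umulFn ∘ fanoutFn sndF (List.cons true ∘ (sndF ∘ fstF ∘ fstF))) (sndF ∘ fstF ∘ fstF))
          (fstF ∘ fstF ∘ fstF)) r}),
    ballLang_mem_P _ (union_mem_P (preimage_mem_P (LenLe_mem_P X) (fanoutFn_mem_FP sndF_mem_FP hkR))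
      (setOf_apply_eq_apply_mem_P hdot hoff)), fun u m k y => ?_⟩
  set ROW := ((fanoutFn sndF (fstF ∘ sndF ∘ fstF) ⁻¹' LenLe X) ⊔
      {r | (andParityFn ∘ fanoutFn (dropFn ∘ fanoutFn
          (umulFn ∘ fanoutFn sndF (List.cons true ∘ (sndF ∘ fstF ∘ fstF))) (fstF ∘ fstF ∘ fstF))
          (sndF ∘ sndF ∘ fstF)) r =
        (headBitFn ∘ dropFn ∘ fanoutFn (concatFn ∘ fanoutFn
          (umulFn ∘ fanoutFn sndF (List.cons true ∘ (sndF ∘ fstF ∘ fstF))) (sndF ∘ fstF ∘ fstF))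
          (fstF ∘ fstF ∘ fstF)) r} : Language Bool) with hROW
  set a := boolPair (boolPair u (ones m)) (boolPair (ones k) y) with ha
  have memL_setOf : ∀ (q : List Bool → Prop) (w : List Bool),
      @Membership.mem (List Bool) (Language Bool) _ {v | q v} w ↔ q w := fun _ _ => Iff.rfl
  -- the row test
  have hrow : ∀ j' : ℕ, boolPair a (List.replicate j' true) ∈ ROW ↔
      k ≤ j' ∨ rowParity u m y j' = false := by
    intro j'
    rw [hROW, PPSharpP.memL_sup, memL_preimage, memL_setOf]
    have hs : (umulFn ∘ fanoutFn sndF (List.cons true ∘ (sndF ∘ fstF ∘ fstF)))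
        (boolPair a (List.replicate j' true)) = ones (rowStart m j') := by
      simp only [Function.comp_apply, fanoutFn_apply, sndF_boolPair, fstF_boolPair, ha]
      rw [show true :: ones m = ones (m + 1) by simp [ones, List.replicate_succ],
        show List.replicate j' true = ones j' from rfl, umulFn_boolPair]
      rfl
    simp only [Function.comp_apply, fanoutFn_apply] at hs ⊢
    rw [hs]
    simp only [ha, sndF_boolPair, fstF_boolPair, boolPair_mem_LenLe, eval_X, dropFn_boolPair,
      concatFn_boolPair, andParityFn_boolPair, headBitFn_apply, ones, List.length_replicate,
      List.length_append, List.cons.injEq, and_true]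
    have hhead : (List.drop (rowStart m j' + m) u).headD false = coinBit u (rowStart m j' + m) := by
      rw [coinBit, List.getD_eq_getElem?_getD, List.headD_eq_head?_getD, List.head?_drop]
    rw [hhead]
    unfold rowParity
    cases decide (Odd (((u.drop (rowStart m j')).zipWith (· && ·) y).count true)) <;>
      cases coinBit u (rowStart m j' + m) <;> simp
  rw [mem_ballLang]
  have hlen : k ≤ X.eval a.length := by
    simp only [eval_X, ha, length_boolPair, ones, List.length_replicate]; omega
  constructor
  · intro h j' hj'
    exact ((hrow j').1 (h j' (lt_of_lt_of_le hj' hlen))).resolve_left (by omega)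
  · intro h j' _
    exact (hrow j').2 (if hk : k ≤ j' then Or.inl hk else Or.inr (h j' (by omega)))

/-! ### The block test -/

/-- **The block test is in `P`** (one factor `p − 1 + #ψ_{j,k}` of Lemma 3.2(4) as a witness
format): for `R ∈ P`, a hash test `HZ` as in `exists_hashZeroLang`, there is `BL ∈ P` with
`⟨⟨x, ⟨u, 1^m⟩⟩, ⟨1^k, b⟩⟩ ∈ BL` iff, writing `b = y e` with `|y| = m`: either `e = 0…0`,
`⟨x, y⟩ ∈ R` and `y` hashes to `0` at level `k` under `u` (a counted witness), or `e` has exactly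
one `1` and `y = 0…0` (one of the `|e|` dummy witnesses). [cite: Burgisser2000TCS, Lemma 3.2(3)–(4) p. 78] -/
theorem exists_blockLang {R : Language Bool} (hR : R ∈ Classes.P) :
    ∃ BL : Language Bool, BL ∈ Classes.P ∧
      ∀ (x u : List Bool) (m k : ℕ) (b : List Bool),
        boolPair (boolPair x (boolPair u (ones m))) (boolPair (ones k) b) ∈ BL ↔
          (b.drop m = List.replicate (b.drop m).length false ∧ boolPair x (b.take m) ∈ R ∧
              HashesToZero u m k (b.take m)) ∨
            ((b.drop m).count true = 1 ∧ b.take m = List.replicate (b.take m).length false) := by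
  obtain ⟨HZ, hHZ, hHZiff⟩ := exists_hashZeroLang
  -- parsers on `c = ⟨⟨x, ⟨u, 1^m⟩⟩, ⟨1^k, b⟩⟩`
  have hxC : (fstF ∘ fstF) ∈ FP := comp_mem_FP fstF_mem_FP fstF_mem_FP
  have huC : (fstF ∘ sndF ∘ fstF) ∈ FP := comp_mem_FP fstF_mem_FP (comp_mem_FP sndF_mem_FP fstF_mem_FP)
  have hmC : (sndF ∘ sndF ∘ fstF) ∈ FP := comp_mem_FP sndF_mem_FP (comp_mem_FP sndF_mem_FP fstF_mem_FP)
  have hkC : (fstF ∘ sndF) ∈ FP := comp_mem_FP fstF_mem_FP sndF_mem_FP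
  have hbC : (sndF ∘ sndF) ∈ FP := comp_mem_FP sndF_mem_FP sndF_mem_FP
  have hyC : (takeFn ∘ fanoutFn (sndF ∘ sndF ∘ fstF) (sndF ∘ sndF)) ∈ FP :=
    comp_mem_FP takeFn_mem_FP (fanoutFn_mem_FP hmC hbC)
  have heC : (dropFn ∘ fanoutFn (sndF ∘ sndF ∘ fstF) (sndF ∘ sndF)) ∈ FP :=
    comp_mem_FP dropFn_mem_FP (fanoutFn_mem_FP hmC hbC)
  refine ⟨({c | (dropFn ∘ fanoutFn (sndF ∘ sndF ∘ fstF) (sndF ∘ sndF)) c =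
        (Kannan.zerosFn ∘ (dropFn ∘ fanoutFn (sndF ∘ sndF ∘ fstF) (sndF ∘ sndF))) c} ⊓
      (fanoutFn (fstF ∘ fstF) (takeFn ∘ fanoutFn (sndF ∘ sndF ∘ fstF) (sndF ∘ sndF)) ⁻¹' R) ⊓
      (fanoutFn (fanoutFn (fstF ∘ sndF ∘ fstF) (sndF ∘ sndF ∘ fstF))
        (fanoutFn (fstF ∘ sndF) (takeFn ∘ fanoutFn (sndF ∘ sndF ∘ fstF) (sndF ∘ sndF))) ⁻¹' HZ)) ⊔
    ({c | (popCountFn ∘ (dropFn ∘ fanoutFn (sndF ∘ sndF ∘ fstF) (sndF ∘ sndF))) c =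
        (fun _ => encodeNat 1) c} ⊓
      {c | (takeFn ∘ fanoutFn (sndF ∘ sndF ∘ fstF) (sndF ∘ sndF)) c =
        (Kannan.zerosFn ∘ (takeFn ∘ fanoutFn (sndF ∘ sndF ∘ fstF) (sndF ∘ sndF))) c}),
    union_mem_P (inter_mem_P (inter_mem_P (setOf_apply_eq_apply_mem_P heC
      (comp_mem_FP Kannan.zerosFn_mem_FP heC)) (preimage_mem_P hR (fanoutFn_mem_FP hxC hyC)))
      (preimage_mem_P hHZ (fanoutFn_mem_FP (fanoutFn_mem_FP huC hmC) (fanoutFn_mem_FP hkC hyC))))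
      (inter_mem_P (setOf_apply_eq_apply_mem_P (comp_mem_FP popCountFn_mem_FP heC) (const_mem_FP _))
        (setOf_apply_eq_apply_mem_P hyC (comp_mem_FP Kannan.zerosFn_mem_FP hyC))),
    fun x u m k b => ?_⟩
  have memL_setOf : ∀ (q : List Bool → Prop) (w : List Bool),
      @Membership.mem (List Bool) (Language Bool) _ {v | q v} w ↔ q w := fun _ _ => Iff.rfl
  rw [PPSharpP.memL_sup, Language.mem_inf, Language.mem_inf, Language.mem_inf, memL_preimage,
    memL_preimage, memL_setOf, memL_setOf, memL_setOf]
  simp only [Function.comp_apply, fanoutFn_apply, fstF_boolPair, sndF_boolPair, takeFn_boolPair,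
    dropFn_boolPair, Kannan.zerosFn_apply, popCountFn_apply, hHZiff, ones, List.length_replicate]
  have henc : ∀ c : ℕ, encodeNat c = encodeNat 1 ↔ c = 1 := fun c =>
    ⟨fun h => by simpa [decode_encodeNat] using congrArg decodeNat h, fun h => by rw [h]⟩
  rw [henc]
  simp only [and_assoc]

/-! ### The relation and its witness count -/

/-- **The isolation relation** (Bürgisser 2000 TCS, proof of Thm. 3.1 with Lemma 3.2(4): the cnf
`φ` with `#φ = 1 + ∏ⱼ (p − 1 + #ψⱼ)` built from the Valiant–Vazirani restrictions `ψⱼ` of a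
verifier, as a witness format). For `R ∈ P` and a number `d` of dummies there is `R'' ∈ P` such
that for every input `x`, witness length `m`, list of seeds `us = [u₀, …, u_{t−1}]` and every
`M' ≥ t·Lv·(m + d) + 1` (`Lv = 2⌊(m+3)/2⌋ + 1` levels), the number of `W ∈ {0,1}^{M'}` with
`⟨⟨x, ⟨1^m, ⟨1^t, ⟨u₀, ⟨u₁, …⟩⟩⟩⟩⟩, W⟩ ∈ R''` is
`1 + ∏_{i < t·Lv} (d + Y_{i / Lv, i % Lv}(x))`, `Y_{j,k}(x) = levelCount R m x uⱼ k` the number of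
`R`-witnesses of `x` hashed to `0` at level `k` by the seed `uⱼ`. Format of `W`: a flag bit
(`1 0…0`: the extra witness; `0 …`: the blocks), `t·Lv` blocks `y e` tested by `exists_blockLang`
on `⟨⟨x, ⟨uⱼ, 1^m⟩⟩, ⟨1^k, y e⟩⟩`, `(j, k) = (i / Lv, i % Lv)` (`Plumb.divModFn`, seed `uⱼ` by
`HashBricks.nthItemFn`), all-ones padding beyond position `t·Lv·(m+d) + 1`; the count is
`cnt_flag`, `cnt_blocks`, `cnt_block`. [cite: Burgisser2000TCS, Thm. 3.1 and Lemma 3.2(4) pp. 77–78] -/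
theorem exists_isolationRel {R : Language Bool} (hR : R ∈ Classes.P) (d : ℕ) :
    ∃ R'' : Language Bool, R'' ∈ Classes.P ∧
      ∀ (x : List Bool) (m : ℕ) (us : List (List Bool)) (M' : ℕ),
        us.length * (2 * ((m + 3) / 2) + 1) * (m + d) + 1 ≤ M' →
          countWitnesses R'' M'
              (boolPair x (boolPair (ones m) (boolPair (ones us.length) (body us)))) =
            1 + ∏ i ∈ Finset.range (us.length * (2 * ((m + 3) / 2) + 1)),
              (d + levelCount R m x (us.getD (i / (2 * ((m + 3) / 2) + 1)) [])
                (i % (2 * ((m + 3) / 2) + 1))) := by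
  obtain ⟨BL, hBL, hBLiff⟩ := exists_blockLang hR
  -- parsers on `s = ⟨⟨x, A⟩, W⟩`, `A = ⟨1^m, ⟨1^t, U⟩⟩` (opaque names with defining equations)
  obtain ⟨xS, hxS⟩ : ∃ f : List Bool → List Bool, f = fstF ∘ fstF := ⟨_, rfl⟩
  obtain ⟨AS, hAS⟩ : ∃ f : List Bool → List Bool, f = sndF ∘ fstF := ⟨_, rfl⟩
  obtain ⟨mS, hmS⟩ : ∃ f : List Bool → List Bool, f = fstF ∘ AS := ⟨_, rfl⟩
  obtain ⟨tS, htS⟩ : ∃ f : List Bool → List Bool, f = fstF ∘ sndF ∘ AS := ⟨_, rfl⟩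
  obtain ⟨US, hUS⟩ : ∃ f : List Bool → List Bool, f = sndF ∘ sndF ∘ AS := ⟨_, rfl⟩
  obtain ⟨LvS, hLvS⟩ : ∃ f : List Bool → List Bool, f = List.cons true ∘ umulFn ∘
      fanoutFn (fun _ => ones 2) (fstF ∘ divModFn ∘ fanoutFn (fun _ => ones 2)
        (concatFn ∘ fanoutFn mS (fun _ => ones 3))) := ⟨_, rfl⟩
  obtain ⟨FS, hFS⟩ : ∃ f : List Bool → List Bool, f = umulFn ∘ fanoutFn tS LvS := ⟨_, rfl⟩
  obtain ⟨BszS, hBszS⟩ : ∃ f : List Bool → List Bool, f = concatFn ∘ fanoutFn mS (fun _ => ones d) :=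
    ⟨_, rfl⟩
  obtain ⟨MS, hMS⟩ : ∃ f : List Bool → List Bool, f = List.cons true ∘ umulFn ∘ fanoutFn FS BszS :=
    ⟨_, rfl⟩
  obtain ⟨restS, hrestS⟩ : ∃ f : List Bool → List Bool, f = dropFn ∘ fanoutFn MS sndF := ⟨_, rfl⟩
  obtain ⟨bodyS, hbodyS⟩ : ∃ f : List Bool → List Bool,
      f = dropFn ∘ fanoutFn (fun _ => [true]) (takeFn ∘ fanoutFn MS sndF) := ⟨_, rfl⟩
  obtain ⟨headS, hheadS⟩ : ∃ f : List Bool → List Bool, f = headBitFn ∘ sndF := ⟨_, rfl⟩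
  -- parsers of the loop, on `v = ⟨s, 1^i⟩`
  obtain ⟨jkV, hjkV⟩ : ∃ f : List Bool → List Bool, f = divModFn ∘ fanoutFn (LvS ∘ fstF) sndF :=
    ⟨_, rfl⟩
  obtain ⟨uV, huV⟩ : ∃ f : List Bool → List Bool,
      f = nthItemFn ∘ fanoutFn (fstF ∘ jkV) (US ∘ fstF) := ⟨_, rfl⟩
  obtain ⟨blkV, hblkV⟩ : ∃ f : List Bool → List Bool, f = takeFn ∘ fanoutFn (BszS ∘ fstF)
      (dropFn ∘ fanoutFn (umulFn ∘ fanoutFn sndF (BszS ∘ fstF)) (bodyS ∘ fstF)) := ⟨_, rfl⟩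
  obtain ⟨argV, hargV⟩ : ∃ f : List Bool → List Bool, f = fanoutFn
      (fanoutFn (xS ∘ fstF) (fanoutFn uV (mS ∘ fstF))) (fanoutFn (sndF ∘ jkV) blkV) := ⟨_, rfl⟩
  -- polynomial time
  have hxSP : xS ∈ FP := hxS ▸ comp_mem_FP fstF_mem_FP fstF_mem_FP
  have hASP : AS ∈ FP := hAS ▸ comp_mem_FP sndF_mem_FP fstF_mem_FP
  have hmSP : mS ∈ FP := hmS ▸ comp_mem_FP fstF_mem_FP hASP
  have htSP : tS ∈ FP := htS ▸ comp_mem_FP fstF_mem_FP (comp_mem_FP sndF_mem_FP hASP)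
  have hUSP : US ∈ FP := hUS ▸ comp_mem_FP sndF_mem_FP (comp_mem_FP sndF_mem_FP hASP)
  have hLvSP : LvS ∈ FP := hLvS ▸ comp_mem_FP (cons_mem_FP true) (comp_mem_FP umulFn_mem_FP
    (fanoutFn_mem_FP (const_mem_FP _) (comp_mem_FP fstF_mem_FP (comp_mem_FP divModFn_mem_FP
      (fanoutFn_mem_FP (const_mem_FP _) (comp_mem_FP concatFn_mem_FP
        (fanoutFn_mem_FP hmSP (const_mem_FP _))))))))
  have hFSP : FS ∈ FP := hFS ▸ comp_mem_FP umulFn_mem_FP (fanoutFn_mem_FP htSP hLvSP)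
  have hBszSP : BszS ∈ FP := hBszS ▸ comp_mem_FP concatFn_mem_FP (fanoutFn_mem_FP hmSP (const_mem_FP _))
  have hMSP : MS ∈ FP :=
    hMS ▸ comp_mem_FP (cons_mem_FP true) (comp_mem_FP umulFn_mem_FP (fanoutFn_mem_FP hFSP hBszSP))
  have hrestSP : restS ∈ FP := hrestS ▸ comp_mem_FP dropFn_mem_FP (fanoutFn_mem_FP hMSP sndF_mem_FP)
  have hbodySP : bodyS ∈ FP := hbodyS ▸ comp_mem_FP dropFn_mem_FP (fanoutFn_mem_FP (const_mem_FP _)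
    (comp_mem_FP takeFn_mem_FP (fanoutFn_mem_FP hMSP sndF_mem_FP)))
  have hheadSP : headS ∈ FP := hheadS ▸ comp_mem_FP headBitFn_mem_FP sndF_mem_FP
  have hjkVP : jkV ∈ FP :=
    hjkV ▸ comp_mem_FP divModFn_mem_FP (fanoutFn_mem_FP (comp_mem_FP hLvSP fstF_mem_FP) sndF_mem_FP)
  have huVP : uV ∈ FP := huV ▸ comp_mem_FP nthItemFn_mem_FP
    (fanoutFn_mem_FP (comp_mem_FP fstF_mem_FP hjkVP) (comp_mem_FP hUSP fstF_mem_FP))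
  have hblkVP : blkV ∈ FP := hblkV ▸ comp_mem_FP takeFn_mem_FP (fanoutFn_mem_FP
    (comp_mem_FP hBszSP fstF_mem_FP) (comp_mem_FP dropFn_mem_FP (fanoutFn_mem_FP
      (comp_mem_FP umulFn_mem_FP (fanoutFn_mem_FP sndF_mem_FP (comp_mem_FP hBszSP fstF_mem_FP)))
      (comp_mem_FP hbodySP fstF_mem_FP))))
  have hargVP : argV ∈ FP := hargV ▸ fanoutFn_mem_FP
    (fanoutFn_mem_FP (comp_mem_FP hxSP fstF_mem_FP) (fanoutFn_mem_FP huVP (comp_mem_FP hmSP fstF_mem_FP)))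
    (fanoutFn_mem_FP (comp_mem_FP sndF_mem_FP hjkVP) hblkVP)
  -- the relation
  refine ⟨{s | restS s = (onesFn ∘ restS) s} ⊓
      (({s | headS s = (fun _ => [true]) s} ⊓ {s | bodyS s = (Kannan.zerosFn ∘ bodyS) s}) ⊔
        ({s | headS s = (fun _ => [false]) s} ⊓
          ballLang ((X + 4) ^ 2) ((fanoutFn sndF (FS ∘ fstF) ⁻¹' LenLe X) ⊔ (argV ⁻¹' BL)))),
    inter_mem_P (setOf_apply_eq_apply_mem_P hrestSP (comp_mem_FP onesFn_mem_FP hrestSP))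
      (union_mem_P (inter_mem_P (setOf_apply_eq_apply_mem_P hheadSP (const_mem_FP _))
        (setOf_apply_eq_apply_mem_P hbodySP (comp_mem_FP Kannan.zerosFn_mem_FP hbodySP)))
        (inter_mem_P (setOf_apply_eq_apply_mem_P hheadSP (const_mem_FP _))
          (ballLang_mem_P _ (union_mem_P (preimage_mem_P (LenLe_mem_P X)
            (fanoutFn_mem_FP sndF_mem_FP (comp_mem_FP hFSP fstF_mem_FP))) (preimage_mem_P hBL hargVP))))),
    fun x m us M' hM' => ?_⟩
  set RR := ({s | restS s = (onesFn ∘ restS) s} ⊓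
      (({s | headS s = (fun _ => [true]) s} ⊓ {s | bodyS s = (Kannan.zerosFn ∘ bodyS) s}) ⊔
        ({s | headS s = (fun _ => [false]) s} ⊓
          ballLang ((X + 4) ^ 2) ((fanoutFn sndF (FS ∘ fstF) ⁻¹' LenLe X) ⊔ (argV ⁻¹' BL)))) :
      Language Bool) with hRR
  -- notation
  set t := us.length with ht
  set Lv := 2 * ((m + 3) / 2) + 1 with hLv
  set N := t * Lv * (m + d) with hN
  set z := boolPair x (boolPair (ones m) (boolPair (ones t) (body us))) with hz
  have memL_setOf : ∀ (q : List Bool → Prop) (w : List Bool),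
      @Membership.mem (List Bool) (Language Bool) _ {v | q v} w ↔ q w := fun _ _ => Iff.rfl
  have hones_add : ∀ a b : ℕ, ones a ++ ones b = ones (a + b) := fun a b =>
    List.replicate_append_replicate ..
  have hones_succ : ∀ a : ℕ, true :: ones a = ones (a + 1) := fun a => by
    simp [ones, List.replicate_succ]
  -- values of the parsers at `s = ⟨z, W⟩`
  have h_xS : ∀ W, xS (boolPair z W) = x := fun W => by simp [hxS, hz]
  have h_mS : ∀ W, mS (boolPair z W) = ones m := fun W => by simp [hmS, hAS, hz]
  have h_tS : ∀ W, tS (boolPair z W) = ones t := fun W => by simp [htS, hAS, hz]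
  have h_US : ∀ W, US (boolPair z W) = body us := fun W => by simp [hUS, hAS, hz]
  have h_LvS : ∀ W, LvS (boolPair z W) = ones Lv := fun W => by
    simp only [hLvS, Function.comp_apply, fanoutFn_apply, h_mS, concatFn_boolPair, hones_add,
      divModFn_boolPair, fstF_boolPair, umulFn_boolPair, hones_succ, hLv]
  have h_FS : ∀ W, FS (boolPair z W) = ones (t * Lv) := fun W => by
    simp only [hFS, Function.comp_apply, fanoutFn_apply, h_tS, h_LvS, umulFn_boolPair]
  have h_BszS : ∀ W, BszS (boolPair z W) = ones (m + d) := fun W => by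
    simp only [hBszS, Function.comp_apply, fanoutFn_apply, h_mS, concatFn_boolPair, hones_add]
  have h_MS : ∀ W, MS (boolPair z W) = ones (N + 1) := fun W => by
    simp only [hMS, Function.comp_apply, fanoutFn_apply, h_FS, h_BszS, umulFn_boolPair, hones_succ, hN]
  have h_restS : ∀ W, restS (boolPair z W) = W.drop (N + 1) := fun W => by
    simp only [hrestS, Function.comp_apply, fanoutFn_apply, h_MS, sndF_boolPair, dropFn_boolPair, ones,
      List.length_replicate]
  have h_bodyS : ∀ W, bodyS (boolPair z W) = (W.take (N + 1)).drop 1 := fun W => by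
    simp only [hbodyS, Function.comp_apply, fanoutFn_apply, h_MS, sndF_boolPair, takeFn_boolPair,
      dropFn_boolPair, ones, List.length_replicate, List.length_singleton]
  have h_headS : ∀ W, headS (boolPair z W) = [W.headD false] := fun W => by
    simp only [hheadS, Function.comp_apply, sndF_boolPair, headBitFn_apply]
  -- values of the loop parsers at `v = ⟨⟨z, W⟩, 1^i⟩`
  have h_jkV : ∀ W i, jkV (boolPair (boolPair z W) (List.replicate i true)) =
      boolPair (ones (i / Lv)) (ones (i % Lv)) := fun W i => by
    simp only [hjkV, Function.comp_apply, fanoutFn_apply, fstF_boolPair, sndF_boolPair, h_LvS]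
    exact divModFn_boolPair Lv i
  have h_uV : ∀ W i, uV (boolPair (boolPair z W) (List.replicate i true)) = us.getD (i / Lv) [] :=
    fun W i => by
    simp only [huV, Function.comp_apply, fanoutFn_apply, h_jkV, fstF_boolPair, h_US, nthItemFn_body]
  have h_blkV : ∀ W i, blkV (boolPair (boolPair z W) (List.replicate i true)) =
      ((((W.take (N + 1)).drop 1).drop (i * (m + d))).take (m + d)) := fun W i => by
    simp only [hblkV, Function.comp_apply, fanoutFn_apply, fstF_boolPair, sndF_boolPair, h_BszS,
      h_bodyS]
    rw [show List.replicate i true = ones i from rfl, umulFn_boolPair, dropFn_boolPair,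
      takeFn_boolPair]
    simp only [ones, List.length_replicate]
  have h_argV : ∀ W i, argV (boolPair (boolPair z W) (List.replicate i true)) =
      boolPair (boolPair x (boolPair (us.getD (i / Lv) []) (ones m)))
        (boolPair (ones (i % Lv)) ((((W.take (N + 1)).drop 1).drop (i * (m + d))).take (m + d))) :=
    fun W i => by
    simp only [hargV, fanoutFn_apply, Function.comp_apply, fstF_boolPair, sndF_boolPair, h_xS, h_uV,
      h_mS, h_jkV, h_blkV]
  -- the loop test
  have hloop : ∀ W i, boolPair (boolPair z W) (List.replicate i true) ∈
      ((fanoutFn sndF (FS ∘ fstF) ⁻¹' LenLe X) ⊔ (argV ⁻¹' BL) : Language Bool) ↔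
      t * Lv ≤ i ∨
        ((((((W.take (N + 1)).drop 1).drop (i * (m + d))).take (m + d)).drop m =
            List.replicate (((((W.take (N + 1)).drop 1).drop (i * (m + d))).take (m + d)).drop m).length
              false ∧
          boolPair x (((((W.take (N + 1)).drop 1).drop (i * (m + d))).take (m + d)).take m) ∈ R ∧
          HashesToZero (us.getD (i / Lv) []) m (i % Lv)
            (((((W.take (N + 1)).drop 1).drop (i * (m + d))).take (m + d)).take m)) ∨
        ((((((W.take (N + 1)).drop 1).drop (i * (m + d))).take (m + d)).drop m).count true = 1 ∧
          ((((W.take (N + 1)).drop 1).drop (i * (m + d))).take (m + d)).take m =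
            List.replicate (((((W.take (N + 1)).drop 1).drop (i * (m + d))).take (m + d)).take m).length
              false)) := fun W i => by
    rw [PPSharpP.memL_sup, memL_preimage, memL_preimage, fanoutFn_apply, sndF_boolPair,
      Function.comp_apply, fstF_boolPair, h_FS, boolPair_mem_LenLe, eval_X, h_argV, hBLiff]
    simp only [ones, List.length_replicate]
  -- the block events and the specification of the relation
  obtain ⟨OK, hOK⟩ : ∃ OK : ℕ → Set (List Bool), OK = fun i => {b |
      (b.drop m = List.replicate (b.drop m).length false ∧ boolPair x (b.take m) ∈ R ∧
          HashesToZero (us.getD (i / Lv) []) m (i % Lv) (b.take m)) ∨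
        ((b.drop m).count true = 1 ∧ b.take m = List.replicate (b.take m).length false)} := ⟨_, rfl⟩
  have hball : ∀ (Q F : ℕ) (B : ℕ → Prop), F ≤ Q → ((∀ i < Q, F ≤ i ∨ B i) ↔ ∀ i < F, B i) := by
    intro Q F B hFQ
    constructor
    · intro h i hi; exact (h i (lt_of_lt_of_le hi hFQ)).resolve_left (by omega)
    · intro h i _
      exact if hFi : F ≤ i then Or.inl hFi else Or.inr (h i (by omega))
  have hLv4 : Lv ≤ m + 4 := by rw [hLv]; omega
  have htz : t ≤ z.length := by simp only [hz, length_boolPair, List.length_replicate]; omega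
  have hmz : m ≤ z.length := by simp only [hz, length_boolPair, List.length_replicate]; omega
  have hmem : ∀ W, boolPair z W ∈ RR ↔
      (W.drop (N + 1) = List.replicate (W.drop (N + 1)).length true ∧
        ((W.headD false = true ∧
            (W.take (N + 1)).drop 1 = List.replicate ((W.take (N + 1)).drop 1).length false) ∨
          (W.headD false = false ∧
            ∀ i < t * Lv, (((W.take (N + 1)).drop 1).drop (i * (m + d))).take (m + d) ∈ OK i))) := by
    intro W
    have hF : t * Lv ≤ ((X + 4) ^ 2 : ℕ[X]).eval (boolPair z W).length := by
      have h1 : t * Lv ≤ z.length * (z.length + 4) := Nat.mul_le_mul htz (by omega)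
      have h2 : ((X + 4) ^ 2 : ℕ[X]).eval (boolPair z W).length = ((boolPair z W).length + 4) ^ 2 := by
        simp [eval_pow]
      have hzs : z.length ≤ (boolPair z W).length := by
        simp only [length_boolPair]; omega
      have h3 : z.length * (z.length + 4) ≤ ((boolPair z W).length + 4) ^ 2 := by
        rw [pow_two]
        exact Nat.mul_le_mul (hzs.trans (Nat.le_add_right _ _)) (Nat.add_le_add_right hzs 4)
      rw [h2]
      exact h1.trans h3
    rw [hRR, Language.mem_inf, PPSharpP.memL_sup, Language.mem_inf, Language.mem_inf, memL_setOf,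
      memL_setOf, memL_setOf, memL_setOf, mem_ballLang]
    simp only [Function.comp_apply, h_restS, h_headS, h_bodyS, onesFn, unaryEncodeNat_eq_replicate,
      Kannan.zerosFn_apply, List.cons.injEq, and_true, hloop, hball _ _ _ hF]
    rw [hOK]
    exact Iff.rfl
  -- the count: semantics and product form at length `M' = (N + 1) + e`
  rw [PPSharpP.countWitnesses_eq_cnt]
  obtain ⟨e, he⟩ : ∃ e, M' = (N + 1) + e := ⟨M' - (N + 1), by omega⟩
  have htake_head : ∀ (W : List Bool) (n : ℕ), (W.take (n + 1)).headD false = W.headD false := by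
    intro W n; cases W <;> rfl
  rw [he, cnt_congr (E := {y | boolPair z y ∈ RR}) (E' := {W | W.take (N + 1) ∈
      {w : List Bool | (w.headD false = true ∧ w.drop 1 = List.replicate N false) ∨
        (w.headD false = false ∧ w.drop 1 ∈
          {w' : List Bool | ∀ i < t * Lv, (w'.drop (i * (m + d))).take (m + d) ∈ OK i})} ∧
      W.drop (N + 1) ∈ {v : List Bool | v = List.replicate e true}}) fun W hW => by
    simp only [Set.mem_setOf_eq]
    rw [hmem W, htake_head, List.length_drop, List.length_drop, List.length_take, hW,
      min_eq_left (Nat.le_add_right _ _), Nat.add_sub_cancel_left, Nat.add_sub_cancel]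
    exact and_comm]
  rw [cnt_take_drop, cnt_eq_replicate_true, mul_one, Nat.add_comm N 1, cnt_flag, hN, cnt_blocks]
  -- per block
  congr 1
  refine Finset.prod_congr rfl fun i _ => ?_
  have hblock : cnt (m + d) (OK i) =
      cnt m {y | boolPair x y ∈ R ∧ HashesToZero (us.getD (i / Lv) []) m (i % Lv) y} + d := by
    rw [← cnt_block, hOK]
    refine cnt_congr fun b hb => ?_
    simp only [Set.mem_setOf_eq]
    rw [List.length_drop, List.length_take, hb, Nat.add_sub_cancel_left, min_eq_left (by omega)]
  have hlc : levelCount R m x (us.getD (i / Lv) []) (i % Lv) =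
      cnt m {y | boolPair x y ∈ R ∧ HashesToZero (us.getD (i / Lv) []) m (i % Lv) y} := by
    classical
    unfold levelCount cnt
    congr 1
    ext y
    simp only [Finset.mem_filter, Finset.mem_univ, true_and, Set.mem_setOf_eq]
  rw [hblock, hlc, Nat.add_comm]

/-! ### Witnesses of exact length for `NP` languages -/

/-- **`NP` through a positive `#P` count at one witness length** (Bürgisser 2000 TCS, p. 75:
"The class `NP` consists of the languages `{x | φ(x) ≥ 1}`, `φ ∈ #P`"): for `L ∈ NP = ∃ᵖ·P` there
are `R₀ ∈ P` and a polynomial `q` with `x ∈ L ↔ #{y ∈ {0,1}^{q(|x|)} | ⟨x, y⟩ ∈ R₀} > 0`. The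
witnesses of all lengths `≤ p(|x|)` are read off coin strings `0 y'`, `|y'| = 2p(|x|)`, by the
self-delimiting decoder `CoinMaps.dec` of `CountingHierarchyPH.lean` (the construction of
`polyExists_subset_pMajority` there, without the accepting half). [cite: Burgisser2000TCS, §2 p. 75] -/
theorem exists_pos_countWitnesses_iff_of_mem_NP {L : Language Bool} (hL : L ∈ Nondeterministic.NP) :
    ∃ R₀ : Language Bool, R₀ ∈ Classes.P ∧ ∃ q : Polynomial ℕ, ∀ x : List Bool,
      x ∈ L ↔ 0 < countWitnesses R₀ (q.eval x.length) x := by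
  obtain ⟨L', hL', p, hp⟩ := hL
  refine ⟨sndStartsWith false ⊓ CoinMaps.decT.eval ⁻¹' L',
    inter_mem_P (sndStartsWith_mem_P false) (preimage_mem_P hL' CoinMaps.decT_mem_FP), 2 * p + 1,
    fun x => ?_⟩
  have hmemW : ∀ (b : Bool) (y : List Bool),
      boolPair x (b :: y) ∈ (sndStartsWith false ⊓ CoinMaps.decT.eval ⁻¹' L' : Language Bool) ↔
        b = false ∧ boolPair x (CoinMaps.dec y) ∈ L' := by
    intro b y
    rw [Language.mem_inf, memL_preimage, boolPair_mem_sndStartsWith, CoinMaps.decT_eval]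
    simp
  rw [hp x, PPSharpP.countWitnesses_eq_cnt]
  have hm : (2 * p + 1 : ℕ[X]).eval x.length = 2 * p.eval x.length + 1 := by simp
  rw [hm, cnt_succ]
  generalize p.eval x.length = q
  have h1 : cnt (2 * q) {y : List Bool | true :: y ∈
      {c : List Bool | boolPair x c ∈ (sndStartsWith false ⊓ CoinMaps.decT.eval ⁻¹' L' : Language Bool)}} = 0 := by
    have := (cnt_pos_iff (2 * q) {y : List Bool | true :: y ∈
      {c : List Bool | boolPair x c ∈ (sndStartsWith false ⊓ CoinMaps.decT.eval ⁻¹' L' : Language Bool)}}).not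
    simp only [not_lt, Nat.le_zero] at this
    refine this.2 ?_
    rintro ⟨y, -, hy⟩
    have hy' := (hmemW true y).1 hy
    simp at hy'
  have h0 : cnt (2 * q) {y : List Bool | false :: y ∈
      {c : List Bool | boolPair x c ∈ (sndStartsWith false ⊓ CoinMaps.decT.eval ⁻¹' L' : Language Bool)}} =
      cnt (2 * q) {y | boolPair x (CoinMaps.dec y) ∈ L'} :=
    cnt_congr fun y _ => by
      change boolPair x (false :: y) ∈ (sndStartsWith false ⊓ CoinMaps.decT.eval ⁻¹' L' : Language Bool) ↔
        boolPair x (CoinMaps.dec y) ∈ L'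
      rw [hmemW]; simp
  rw [h0, h1, add_zero, cnt_pos_iff]
  constructor
  · rintro ⟨y, hy, hyL⟩
    refine ⟨CoinMaps.enc y ++ List.replicate (2 * q - 2 * y.length) false, ?_, ?_⟩
    · simp [CoinMaps.length_enc]; omega
    · change boolPair x (CoinMaps.dec (CoinMaps.enc y ++ List.replicate _ false)) ∈ L'
      rwa [CoinMaps.dec_enc_append_replicate]
  · rintro ⟨y', hy', hmem⟩
    have hlen := CoinMaps.two_mul_length_dec_le y'
    exact ⟨CoinMaps.dec y', by omega, hmem⟩

end Literature.Computability.Complexity
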